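import Literature.NumberTheory.GaloisRepresentations.DecompositionGroupNested
import HarnessLib

/-!
# Decomposition groups of primes above distinct places are not commensurable

Topic `NumberTheory/GaloisRepresentations`; theorems only (no definition, no named fact), sequel of
`DecompositionGroupCommTerminal.lean` and `DecompositionGroupNested.lean` (notation as there: `K` a number field, `v`, `w` finite
places, `K_v = v.adicCompletion K`, `ι_v : K̄ → \bar K_v` the chosen embedding, `res_v : Γ_{K_v} → Γ_K`,
`𝔓₀(v) = adicCompletionPrime K v` the prime of `\bar ℤ_K` above `v` cut out by `ι_v`,
`D_𝔓 = 𝔓.decompositionSubgroup Γ_K`).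

`DecompositionGroupCommTerminal.smul_eq_of_relIndex_ne_zero_of_mem_primesAbove` is the number-field
case of [NSW] Cor. 12.1.3 for two primes ABOVE THE SAME place `v` (`𝔓` and `σ 𝔓`: a finite-index
intersection `D_𝔓 ∩ D_{σ𝔓}` forces `σ 𝔓 = 𝔓`), and `DecompositionGroupNested.eq_of_decompositionSubgroup_le`
treats NESTED decomposition groups of primes above two places (`D_𝔓 ≤ D_𝔔 ⇒ 𝔓 = 𝔔`).  This file
proves the FINITE-INDEX (commensurability) form across two DISTINCT places, which contains both:

* **`relIndex_decompositionSubgroup_eq_zero_of_ne`** — for `v ≠ w` and primes `𝔓 ∣ v`, `𝔔 ∣ w`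
  of `\bar ℤ_K`, `D_𝔓 ∩ D_𝔔` has INFINITE index in `D_𝔓` (`(D_𝔔).relIndex (D_𝔓) = 0`);
* **`eq_of_relIndex_decompositionSubgroup_ne_zero`** — hence for ANY two primes `𝔓 ∣ v`, `𝔔 ∣ w`
  of `\bar ℤ_K`: if `D_𝔓 ∩ D_𝔔` has finite index in `D_𝔓`, then `𝔓 = 𝔔` (and `v = w`):
  distinct nonarchimedean primes of `K̄` have non-commensurable decomposition groups;
* `eq_of_relIndex_decompositionSubgroup_ne_zero'` — and then `v = w`.  (The nested case
  `D_𝔓 ≤ D_𝔔 → 𝔓 = 𝔔` — relative index `1` — is `DecompositionGroupNested.eq_of_decompositionSubgroup_le`,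
  the uniqueness half of Neukirch's correspondence [NSW] (12.1.9).)

**Proof** of the first theorem (no class field theory, no Henselian valuation theory).  Suppose
`H = D_𝔓 ∩ D_𝔔` has finite index in `D_𝔓 = res_v(Γ_{K_v})` (WLOG `𝔓 = 𝔓₀(v)`, `𝔔 = ρ 𝔓₀(w)`).
Then `res_v⁻¹(H)` is a closed subgroup of finite index of `Γ_{K_v}`, hence open, with finite fixed
field `k' ⊆ \bar K_v`, and `ι_v` maps every element of `K̄` fixed by `D_𝔔` into `k'`.  By the
Chinese remainder theorem pick `x ∈ 𝓞 K` with `x ∈ v` and `x - 1 ∈ w`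
(`DecompositionGroupNested.exists_intValuation_eq_exp_neg_one_and_sub_one_mem`), and a prime `ℓ`
invertible in `O_w` (`exists_prime_isUnit_natCast`).  The principal unit `x` of `K_w` is an `ℓ^n`-th power in
`K_w` for every `n` (Hensel, `exists_pow_eq_of_norm_sub_one_lt`); its `ℓ^n`-th roots are algebraic,
i.e. of the form `ι_w(z)` with `z ∈ K̄` fixed by `D_{𝔓₀(w)} = res_w(Γ_{K_w})`
(`exists_eq_absClosureEmbedding_of_pow_eq`, `absGaloisRestrict_smul_eq_of_mem_range`), so
`y = ρ z` is an `ℓ^n`-th root of `x` fixed by `D_𝔔`.  Hence `ι_v(x) ∈ k'` admits `ℓ^n`-th roots in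
`k'` for all `n`, and the discreteness of the valuation of the finite extension `k'/K_v`
(`spectralNorm_eq_one_of_forall_exists_pow_eq`) forces `‖x‖_v = 1` — contradicting `x ∈ v`.

HONEST FRAMING: classical, undisputed algebraic number theory (our kernel check of a refereed
statement); written for the non-archimedean half of the abc-iut GAP row G-L4d2g4-1 (Neukirch:
automorphisms of `Γ_F` permute decomposition groups), whose containment core [NSW] (12.1.9) is NOT
proved here; nothing here bears on [IUTchIII] Cor. 3.12.

## References

* J. Neukirch, A. Schmidt, K. Wingberg, *Cohomology of Number Fields*, Grundlehren 323 (2nd ed.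
  2008), Cor. 12.1.3, Thm. 12.1.9. [NeukirchSchmidtWingberg2008]
* J. Neukirch, *Kennzeichnung der p-adischen und der endlichen algebraischen Zahlkörper*,
  Invent. Math. 6 (1969) 296–314, §2. [Neukirch1969]
* J. Neukirch, *Algebraic Number Theory*, Grundlehren 322 (1999), Ch. II §9 (9.6), Ch. II (4.6)
  (Hensel). [NeukirchANT1999]
-/

noncomputable section

open scoped NumberField Pointwise Valued
open Field IsDedekindDomain Polynomial

universe u

namespace Literature.NumberTheory.GaloisRepresentations

/-! ### Two group-theoretic trivialities -/

/-- The conjugation action of `ConjAct G` and of `MulAut.conj` on subgroups agree. [folklore] -/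
private theorem conjAct_smul_subgroup_eq' {G : Type*} [Group G] (g : G) (H : Subgroup G) :
    ConjAct.toConjAct g • H = MulAut.conj g • H := rfl

/-- The relative index is invariant under simultaneous conjugation
(Mathlib `Subgroup.quotConjEquiv`). [folklore] -/
private theorem relIndex_conj_smul {G : Type*} [Group G] (g : G) (H L : Subgroup G) :
    (MulAut.conj g • H).relIndex (MulAut.conj g • L) = H.relIndex L := by
  rw [← conjAct_smul_subgroup_eq', ← conjAct_smul_subgroup_eq']
  exact (Nat.card_congr (Subgroup.quotConjEquiv H L (ConjAct.toConjAct g))).symm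

variable (K : Type u) [Field K] [NumberField K]

/-! ### Primes above distinct places -/

-- the pointwise `MulAction` of `Γ_K` on the ideals of `\bar ℤ_K` is slow to synthesise
set_option synthInstance.maxHeartbeats 160000 in
/-- **`D_{𝔓₀(v)} ∩ D_{ρ 𝔓₀(w)}` has infinite index in `D_{𝔓₀(v)}` for `v ≠ w`** (core case of
`relIndex_decompositionSubgroup_eq_zero_of_ne`, for the prime `𝔓₀(v)` above `v` cut out by
`K̄ → \bar K_v` and an arbitrary prime `ρ 𝔓₀(w)` above `w`).  See the module docstring for the
proof (CRT, Hensel at `w`, discreteness of the valuation of a finite extension of `K_v`).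
[cite: NeukirchSchmidtWingberg2008, Cor. 12.1.3] -/
theorem relIndex_decompositionSubgroup_adicCompletionPrime_eq_zero_of_ne
    {v w : HeightOneSpectrum (𝓞 K)} (hvw : v ≠ w) (ρ : absoluteGaloisGroup K) :
    ((ρ • adicCompletionPrime K w).decompositionSubgroup (absoluteGaloisGroup K)).relIndex
      ((adicCompletionPrime K v).decompositionSubgroup (absoluteGaloisGroup K)) = 0 := by
  classical
  by_contra h
  haveI : CharZero (v.adicCompletion K) :=
    charZero_of_injective_algebraMap (algebraMap K (v.adicCompletion K)).injective
  haveI : IsGalois (v.adicCompletion K) (AlgebraicClosure (v.adicCompletion K)) := {}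
  set D : Subgroup (absoluteGaloisGroup K) :=
    (ρ • adicCompletionPrime K w).decompositionSubgroup (absoluteGaloisGroup K) with hD
  have hDclosed : IsClosed (D : Set (absoluteGaloisGroup K)) :=
    absIntegers.isClosed_decompositionSubgroup_holds (R := 𝓞 K) (K := K) (ρ • adicCompletionPrime K w)
  -- pull back `D = D_{ρ 𝔓₀(w)}` to `Γ_{K_v}`
  set H : Subgroup (absoluteGaloisGroup (v.adicCompletion K)) :=
    D.comap (absGaloisRestrict K (v.adicCompletion K)).toMonoidHom with hH
  have hindex : H.index ≠ 0 := by
    rw [hH, Subgroup.index_comap, ← decompositionSubgroup_adicCompletionPrime_eq_range]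
    exact h
  haveI : H.FiniteIndex := ⟨hindex⟩
  have hHclosed : IsClosed (H : Set (absoluteGaloisGroup (v.adicCompletion K))) :=
    hDclosed.preimage (absGaloisRestrict K (v.adicCompletion K)).continuous
  have hHopen : IsOpen (H : Set (absoluteGaloisGroup (v.adicCompletion K))) :=
    Subgroup.isOpen_of_isClosed_of_finiteIndex H hHclosed
  -- the finite extension `k'` of `K_v` fixed by `H`
  set H' : Subgroup (AlgebraicClosure (v.adicCompletion K) ≃ₐ[v.adicCompletion K]
      AlgebraicClosure (v.adicCompletion K)) :=
    H.comap (absoluteGaloisGroup.toAlgEquiv (v.adicCompletion K)).symm.toMonoidHom with hH'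
  have hH'open : IsOpen (H' : Set (AlgebraicClosure (v.adicCompletion K) ≃ₐ[v.adicCompletion K]
      AlgebraicClosure (v.adicCompletion K))) := hHopen
  set k' : IntermediateField (v.adicCompletion K) (AlgebraicClosure (v.adicCompletion K)) :=
    IntermediateField.fixedField H' with hk'
  haveI : FiniteDimensional (v.adicCompletion K) k' := by
    rw [← InfiniteGalois.isOpen_iff_finite]
    exact Subgroup.isOpen_mono ((IntermediateField.le_iff_le (H := H') (K := k')).mp le_rfl) hH'open
  -- elements of `K̄` fixed by `D` are mapped into `k'` by `ι_v`
  have hk'mem : ∀ y : AlgebraicClosure K, (∀ g ∈ D, g • y = y) →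
      absClosureEmbedding K (v.adicCompletion K) y ∈ k' := by
    intro y hy
    rw [hk', IntermediateField.mem_fixedField_iff]
    intro f hf
    have hfH : absGaloisRestrict K (v.adicCompletion K)
        ((absoluteGaloisGroup.toAlgEquiv (v.adicCompletion K)).symm f) ∈ D := hf
    have h1 : f (absClosureEmbedding K (v.adicCompletion K) y) =
        ((absoluteGaloisGroup.toAlgEquiv (v.adicCompletion K)).symm f) •
          absClosureEmbedding K (v.adicCompletion K) y :=
      (absoluteGaloisGroup.toAlgEquiv_symm_apply f _).symm
    rw [h1, ← absGaloisRestrict_apply_smul, hy _ hfH]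
  -- the CRT element `x ∈ v`, `x ≡ 1 (mod w)`, and a prime `ℓ` invertible at `w`
  obtain ⟨x, hxval, hxw⟩ := exists_intValuation_eq_exp_neg_one_and_sub_one_mem K hvw
  have hxv : x ∈ v.asIdeal := by
    rw [← HeightOneSpectrum.intValuation_lt_one_iff_mem, hxval, ← WithZero.exp_zero]
    exact WithZero.exp_lt_exp.mpr (by norm_num)
  have hx0 : (x : K) ≠ 0 := by
    intro hx
    have hx' : x = 0 := by exact_mod_cast hx
    rw [hx', zero_sub] at hxw
    exact w.isMaximal.ne_top ((Ideal.eq_top_iff_one _).mpr (by simpa using neg_mem hxw))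
  have hxv' : ‖algebraMap K (v.adicCompletion K) x‖ < 1 := by
    have h' := (norm_algebraMap_ringOfIntegers_lt_one_iff K v x).mpr hxv
    rwa [IsScalarTower.algebraMap_apply (𝓞 K) K (v.adicCompletion K)] at h'
  have hxw' : ‖algebraMap K (w.adicCompletion K) x - 1‖ < 1 := by
    have h' := (norm_algebraMap_ringOfIntegers_lt_one_iff K w (x - 1)).mpr hxw
    rwa [map_sub, map_one, IsScalarTower.algebraMap_apply (𝓞 K) K (w.adicCompletion K)] at h'
  obtain ⟨ℓ, hℓ, hℓu⟩ := exists_prime_isUnit_natCast K w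
  -- for every `n`, an `ℓ^n`-th root of `x` in `K̄` fixed by `D`
  have hroot : ∀ n : ℕ, ∃ y : AlgebraicClosure K,
      y ^ (ℓ ^ n) = algebraMap K (AlgebraicClosure K) x ∧ ∀ g ∈ D, g • y = y := by
    intro n
    have hunit : IsUnit (((ℓ ^ n : ℕ) : ℕ) : w.adicCompletionIntegers K) := by
      rw [Nat.cast_pow]
      exact hℓu.pow n
    obtain ⟨r, hr⟩ := exists_pow_eq_of_norm_sub_one_lt K w hxw' hunit
    have hr' : algebraMap (w.adicCompletion K) (AlgebraicClosure (w.adicCompletion K)) r ^ (ℓ ^ n) =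
        absClosureEmbedding K (w.adicCompletion K) (algebraMap K (AlgebraicClosure K) x) := by
      rw [← map_pow, hr, AlgHom.commutes,
        IsScalarTower.algebraMap_apply K (w.adicCompletion K) (AlgebraicClosure (w.adicCompletion K))]
    obtain ⟨z, hz, hzpow⟩ :=
      exists_eq_absClosureEmbedding_of_pow_eq K w (pow_pos hℓ.pos n) hr'
    refine ⟨ρ • z, ?_, fun g hg => ?_⟩
    · rw [← smul_pow', hzpow, absoluteGaloisGroup.smul_def, AlgEquiv.commutes]
    · rw [hD, Ideal.decompositionSubgroup_smul (absoluteGaloisGroup K) _ ρ,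
        Subgroup.mem_pointwise_smul_iff_inv_smul_mem, MulAut.smul_def, MulAut.conj_inv_apply,
        decompositionSubgroup_adicCompletionPrime_eq_range] at hg
      obtain ⟨τ, hτ⟩ := hg
      have hτ' : absGaloisRestrict K (w.adicCompletion K) τ = ρ⁻¹ * g * ρ := hτ
      have hzfix : absGaloisRestrict K (w.adicCompletion K) τ • z = z :=
        absGaloisRestrict_smul_eq_of_mem_range K w τ ⟨r, hz.symm⟩
      have hg' : g = ρ * (ρ⁻¹ * g * ρ) * ρ⁻¹ := by group
      rw [hg', mul_smul, mul_smul, inv_smul_smul, ← hτ', hzfix]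
  -- `t = ι_v(x) ∈ k'` has `ℓ^n`-th roots in `k'` for every `n`
  set t : AlgebraicClosure (v.adicCompletion K) :=
    algebraMap (v.adicCompletion K) (AlgebraicClosure (v.adicCompletion K))
      (algebraMap K (v.adicCompletion K) x) with ht
  have htmem : t ∈ k' := IntermediateField.algebraMap_mem k' _
  have ht0 : t ≠ 0 := by
    rw [ht, _root_.map_ne_zero, _root_.map_ne_zero]
    exact hx0
  have hdiv : ∀ n : ℕ, ∃ s ∈ k', s ^ (ℓ ^ n) = t := by
    intro n
    obtain ⟨y, hy, hyfix⟩ := hroot n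
    refine ⟨absClosureEmbedding K (v.adicCompletion K) y, hk'mem y hyfix, ?_⟩
    rw [← map_pow, hy, AlgHom.commutes, ht,
      IsScalarTower.algebraMap_apply K (v.adicCompletion K) (AlgebraicClosure (v.adicCompletion K))]
  have h1 := spectralNorm_eq_one_of_forall_exists_pow_eq K v k' hℓ htmem ht0 hdiv
  rw [ht, spectralNorm_extends] at h1
  exact absurd h1 hxv'.ne

-- the pointwise `MulAction` of `Γ_K` on the ideals of `\bar ℤ_K` is slow to synthesise
set_option synthInstance.maxHeartbeats 160000 in
/-- **Primes above distinct places have decomposition groups of infinite mutual index**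
([NSW] Cor. 12.1.3, number-field case, ACROSS places): for finite places `v ≠ w` of `K` and primes
`𝔓 ∣ v`, `𝔔 ∣ w` of `\bar ℤ_K`, the subgroup `D_𝔓 ∩ D_𝔔` has infinite index in `D_𝔓`:
`(D_𝔔).relIndex (D_𝔓) = 0`.  (All primes above `v` are `Γ_K`-conjugate to `𝔓₀(v)`,
`exists_smul_eq_of_mem_primesAbove_holds`, and relative indices are conjugation-invariant.)
[cite: NeukirchSchmidtWingberg2008, Cor. 12.1.3] -/
theorem relIndex_decompositionSubgroup_eq_zero_of_ne {v w : HeightOneSpectrum (𝓞 K)}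
    (hvw : v ≠ w) {𝔓 𝔔 : Ideal (absIntegers (𝓞 K) K)} (h𝔓 : 𝔓 ∈ v.primesAbove)
    (h𝔔 : 𝔔 ∈ w.primesAbove) :
    (𝔔.decompositionSubgroup (absoluteGaloisGroup K)).relIndex
      (𝔓.decompositionSubgroup (absoluteGaloisGroup K)) = 0 := by
  obtain ⟨γ, hγ⟩ := HeightOneSpectrum.exists_smul_eq_of_mem_primesAbove_holds
    (adicCompletionPrime_mem_primesAbove K v) h𝔓
  obtain ⟨δ, hδ⟩ := HeightOneSpectrum.exists_smul_eq_of_mem_primesAbove_holds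
    (adicCompletionPrime_mem_primesAbove K w) h𝔔
  -- conjugate by `γ⁻¹`: `𝔓 = γ 𝔓₀(v)`, `𝔔 = γ ((γ⁻¹ δ) 𝔓₀(w))`
  have e𝔔 : 𝔔 = γ • ((γ⁻¹ * δ) • adicCompletionPrime K w) := by
    rw [← hδ, mul_smul, smul_inv_smul]
  rw [← hγ, e𝔔, Ideal.decompositionSubgroup_smul (absoluteGaloisGroup K) _ γ,
    Ideal.decompositionSubgroup_smul (absoluteGaloisGroup K) (adicCompletionPrime K v) γ,
    relIndex_conj_smul]
  exact relIndex_decompositionSubgroup_adicCompletionPrime_eq_zero_of_ne K hvw (γ⁻¹ * δ)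

/-- **Distinct nonarchimedean primes of `K̄` have non-commensurable decomposition groups**
([NSW] Cor. 12.1.3, number-field case, for ANY two primes of `\bar ℤ_K`): if `𝔓 ∣ v`, `𝔔 ∣ w`
and `D_𝔓 ∩ D_𝔔` has finite index in `D_𝔓`, then `𝔓 = 𝔔`.  For `v ≠ w` this contradicts
`relIndex_decompositionSubgroup_eq_zero_of_ne`; for `v = w` the two primes are conjugate and
`smul_eq_of_relIndex_ne_zero_of_mem_primesAbove` applies. [cite: NeukirchSchmidtWingberg2008, Cor. 12.1.3] -/
theorem eq_of_relIndex_decompositionSubgroup_ne_zero {v w : HeightOneSpectrum (𝓞 K)}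
    {𝔓 𝔔 : Ideal (absIntegers (𝓞 K) K)} (h𝔓 : 𝔓 ∈ v.primesAbove) (h𝔔 : 𝔔 ∈ w.primesAbove)
    (h : (𝔔.decompositionSubgroup (absoluteGaloisGroup K)).relIndex
      (𝔓.decompositionSubgroup (absoluteGaloisGroup K)) ≠ 0) :
    𝔓 = 𝔔 := by
  by_cases hvw : v = w
  · subst hvw
    obtain ⟨σ, hσ⟩ := HeightOneSpectrum.exists_smul_eq_of_mem_primesAbove_holds h𝔓 h𝔔
    rw [← hσ] at h ⊢
    exact (smul_eq_of_relIndex_ne_zero_of_mem_primesAbove K v h𝔓 σ h).symm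
  · exact absurd (relIndex_decompositionSubgroup_eq_zero_of_ne K hvw h𝔓 h𝔔) h

/-- The places agree as well: under the hypotheses of
`eq_of_relIndex_decompositionSubgroup_ne_zero`, `v = w`. [cite: NeukirchSchmidtWingberg2008, Cor. 12.1.3] -/
theorem eq_of_relIndex_decompositionSubgroup_ne_zero' {v w : HeightOneSpectrum (𝓞 K)}
    {𝔓 𝔔 : Ideal (absIntegers (𝓞 K) K)} (h𝔓 : 𝔓 ∈ v.primesAbove) (h𝔔 : 𝔔 ∈ w.primesAbove)
    (h : (𝔔.decompositionSubgroup (absoluteGaloisGroup K)).relIndex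
      (𝔓.decompositionSubgroup (absoluteGaloisGroup K)) ≠ 0) :
    v = w := by
  by_contra hvw
  exact h (relIndex_decompositionSubgroup_eq_zero_of_ne K hvw h𝔓 h𝔔)

end Literature.NumberTheory.GaloisRepresentations

end
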